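import Summits.Ventures.PercRepro.Classify4
import Summits.Ventures.PercRepro.LemmaC7

/-!
# Lemma C with `r` crossing cells, and the reduction of C-008 to it

`kerC r` is the kernel of the cubic `6 · [(T + S)(T S − e₂(x)) − e₃(x)]` on `r + 2` cells
(`0 = ⊤`, `r + 1 = ⊥`, `1, …, r` the crossing cells): `2` on the multisets `{⊤,⊤,⊥}`, `{⊤,⊥,⊥}`,
`−1` on `{⊤, x_i, x_j}`, `{⊥, x_i, x_j}` and `{x_i, x_j, x_l}` with distinct crossing cells, `0`
otherwise.  For `r = 3` it is the C-007 kernel; for `r = 7` (`cubSum_kerC7`) it is the kernel of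
**C-008** (`Summits.Ventures.PercRepro.SMC4`): four marked vertices, `T = π(abcd)`,
`S = P(≥ 3 blocks)`, `x` the seven two-block rows, `(T + S)(T S − e₂(x)) ≥ e₃(x)`.

`cell9` sends a configuration to the coarse cell `⊤ / two-block row / ≥ 3 blocks` (nine values,
built on typer-2's row statistic `row4`); the law of `cell9` is `(T, x₁, …, x₇, S)`
(`prob_cell9_preimage`, `law9`).  The three-copy sorting identity of `LemmaC7`
(`cubSum_law_eq_sum_tripleClass`) then gives C-008 from

**Lemma C(7)** (`LemmaC8`, conjectured; mine-4's Z₃(r = 7) censuses): for every marked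
multigraph and nested triple `v ≤ m ≤ u`, the colourings of the class weighted by `kerC 7` of
the three coarse cells sum to a nonnegative number.  `C008_of_LemmaC8` is the reduction.
-/

namespace PercRepro

open Finset

/-! ### The `r`-family kernel -/

/-- The kernel of the cubic `6 · [(T + S)(TS − e₂) − e₃]` on `r + 2` cells
(`0 = ⊤`, `Fin.last (r+1) = ⊥`, the rest crossing cells). -/
def kerC (r : ℕ) (s t w : Fin (r + 2)) : ℝ :=
  let top : Fin (r + 2) := 0
  let bot : Fin (r + 2) := Fin.last (r + 1)
  let isTop := fun x : Fin (r + 2) => x = top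
  let isBot := fun x : Fin (r + 2) => x = bot
  let isX := fun x : Fin (r + 2) => x ≠ top ∧ x ≠ bot
  if (isTop s ∧ isTop t ∧ isBot w) ∨ (isTop s ∧ isBot t ∧ isTop w) ∨ (isBot s ∧ isTop t ∧ isTop w) ∨
     (isTop s ∧ isBot t ∧ isBot w) ∨ (isBot s ∧ isTop t ∧ isBot w) ∨ (isBot s ∧ isBot t ∧ isTop w)
  then 2
  else if ((isTop s ∨ isBot s) ∧ isX t ∧ isX w ∧ t ≠ w) ∨ ((isTop t ∨ isBot t) ∧ isX s ∧ isX w ∧ s ≠ w) ∨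
          ((isTop w ∨ isBot w) ∧ isX s ∧ isX t ∧ s ≠ t)
  then -1
  else if isX s ∧ isX t ∧ isX w ∧ s ≠ t ∧ s ≠ w ∧ t ≠ w then -1
  else 0

/-- `e₂` of the crossing cells `1, …, 7` of a vector on `Fin 9`. -/
def e2Cross7 (π : Fin 9 → ℝ) : ℝ :=
  ∑ i : Fin 9, ∑ j : Fin 9, if 1 ≤ i ∧ i < j ∧ j ≤ 7 then π i * π j else 0

/-- `e₃` of the crossing cells `1, …, 7` of a vector on `Fin 9`. -/
def e3Cross7 (π : Fin 9 → ℝ) : ℝ :=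
  ∑ i : Fin 9, ∑ j : Fin 9, ∑ l : Fin 9,
    if 1 ≤ i ∧ i < j ∧ j < l ∧ l ≤ 7 then π i * π j * π l else 0

/-- The cubic form of `kerC 7` is `6 · [(T + S)(TS − e₂) − e₃]` with `T = π 0`, `S = π 8`. -/
theorem cubSum_kerC7 (π : Fin 9 → ℝ) :
    cubSum (kerC 7) π =
      6 * ((π 0 + π 8) * (π 0 * π 8 - e2Cross7 π) - e3Cross7 π) := by
  simp only [cubSum, triSum, e2Cross7, e3Cross7, Fin.sum_univ_succ, Fin.sum_univ_zero, kerC]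
  simp
  ring

variable {E : Type*} [Fintype E] [DecidableEq E]

namespace MultiGraph

variable {V : Type*} (G : MultiGraph V E)

/-! ### The coarse cell of four marked vertices -/

/-- The coarse cell of a row of `rgs4`: `0 ↦ 0` (`abcd`), the two-block rows
`1, 2, 3, 5, 6, 8, 9 ↦ 1, …, 7`, the rows with `≥ 3` blocks `↦ 8`. -/
def coarse4 : Fin 15 → Fin 9 := ![0, 1, 2, 3, 8, 4, 5, 8, 6, 7, 8, 8, 8, 8, 8]

/-- The row of a configuration (typer-2's `row4` of the marked partition). -/
noncomputable def rowOf (m : Fin 4 → V) (ω : Config E) : Fin 15 := row4 (G.markedPartition ω m)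

/-- The coarse cell of a configuration. -/
noncomputable def cell9 (m : Fin 4 → V) (ω : Config E) : Fin 9 := coarse4 (G.rowOf m ω)

/-- The fibres of `rowOf` are the rows of the partition law. -/
theorem prob_rowOf_preimage (p : E → ℝ) (a b c d : V) (s : Fin 15) :
    prob p (G.rowOf ![a, b, c, d] ⁻¹' {s}) = G.law4 p a b c d s := by
  unfold law4
  congr 1
  ext ω
  rw [Set.mem_preimage, Set.mem_singleton_iff, rowOf, row4_markedPartition_eq_iff]

/-- The fibres of `cell9` are sums of rows. -/
theorem prob_cell9_preimage (p : E → ℝ) (a b c d : V) (k : Fin 9) :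
    prob p (G.cell9 ![a, b, c, d] ⁻¹' {k}) =
      ∑ s ∈ univ.filter (fun s => coarse4 s = k), G.law4 p a b c d s := by
  have h : G.cell9 ![a, b, c, d] ⁻¹' {k} =
      G.rowOf ![a, b, c, d] ⁻¹' ((univ.filter (fun s => coarse4 s = k) : Finset (Fin 15)) :
        Set (Fin 15)) := by
    ext ω
    simp [cell9]
  rw [h, prob_preimage_coe]
  exact Finset.sum_congr rfl fun s _ => G.prob_rowOf_preimage p a b c d s

/-- The law of `cell9`, row by row. -/
theorem law9 (p : E → ℝ) (a b c d : V) :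
    (fun k => prob p (G.cell9 ![a, b, c, d] ⁻¹' {k})) =
      ![G.law4 p a b c d 0, G.law4 p a b c d 1, G.law4 p a b c d 2, G.law4 p a b c d 3,
        G.law4 p a b c d 5, G.law4 p a b c d 6, G.law4 p a b c d 8, G.law4 p a b c d 9,
        ∑ s ∈ manyBlockRows4, G.law4 p a b c d s] := by
  funext k
  rw [prob_cell9_preimage, Finset.sum_filter]
  fin_cases k <;> simp [Fin.sum_univ_succ, coarse4, manyBlockRows4]

end MultiGraph

/-! ### Lemma C(7) and C-008 -/

/-- **Lemma C with seven crossing cells** (conjectured): for every marked multigraph and every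
nested triple `v ≤ m ≤ u`, the colourings of the class weighted by `kerC 7` of the three coarse
cells sum to a nonnegative number. -/
def LemmaC8 : Prop :=
  ∀ {V E : Type} [Fintype E] [DecidableEq E] (G : MultiGraph V E) (a b c d : V)
    (u m v : Config E), v ≤ m → m ≤ u →
      0 ≤ ∑ φ : ↥(openEdges u \ openEdges v) → Fin 3,
        kerC 7 (G.cell9 ![a, b, c, d] (tripleCopy v m (openEdges u \ openEdges v) φ 0))
          (G.cell9 ![a, b, c, d] (tripleCopy v m (openEdges u \ openEdges v) φ 1))
          (G.cell9 ![a, b, c, d] (tripleCopy v m (openEdges u \ openEdges v) φ 2))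

/-- Under Lemma C(7) every class sum is nonnegative. -/
theorem classSum9_nonneg_of_lemmaC8 (h : LemmaC8) {V E : Type} [Fintype E] [DecidableEq E]
    (G : MultiGraph V E) (a b c d : V) (u m v : Config E) :
    0 ≤ ∑ x ∈ tripleClass u m v, kerC 7 (G.cell9 ![a, b, c, d] x.1)
      (G.cell9 ![a, b, c, d] x.2.1) (G.cell9 ![a, b, c, d] x.2.2) := by
  by_cases hn : v ≤ m ∧ m ≤ u
  · have h' := sum_tripleClass_eq_sum_colourings hn.1 hn.2 (fun x y z =>
      kerC 7 (G.cell9 ![a, b, c, d] x) (G.cell9 ![a, b, c, d] y) (G.cell9 ![a, b, c, d] z))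
    rw [h']
    exact h G a b c d u m v hn.1 hn.2
  · rw [tripleClass_eq_empty_of_not_le hn, Finset.sum_empty]

/-- **C-008 follows from Lemma C(7)** (the three-copy sorting identity). -/
theorem C008_of_LemmaC8 (h : LemmaC8) : C008 := by
  intro V E _ _ G p hp a b c d
  have key := cubSum_law_nonneg_of_classes hp (G.cell9 ![a, b, c, d]) (kerC 7)
    (fun u m v => classSum9_nonneg_of_lemmaC8 h G a b c d u m v)
  rw [G.law9 p a b c d, cubSum_kerC7] at key
  simp only [e2Cross7, e3Cross7, Fin.sum_univ_succ, Fin.sum_univ_zero] at key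
  simp at key
  simp only [e2Rows, e3Rows, twoBlockRows4]
  simp
  nlinarith [key]

end PercRepro
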